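/-
Copyright (c) 2026 the pub-hodgecm-mathlib formalisation cell (harness21).  Prover seat hodgecm-mathlib-F0P3a-p07 (g11): road «S3-tree» (LEAD F0P3a-plan (g11); architect
A-p16 (g29) RULING A-66 «SPAN-0» (3): brick S-a3), 2026-09-01.
-/
import Literature.NumberTheory.Automorphic.UnitaryLatticeTreeTypeTwoChild              -- ★ T1d-C3a (B-p14 (g35)): brings the type-two normal form, `type_unique`, `isVertexLattice_mapGL`, T1a∕T1b
import Literature.NumberTheory.Automorphic.UnitaryLatticeTreeResiduallyUnipotentCorner  -- S-a3 FILE 1 (this seat): `v_pow_sub_one_apply_lt_one`, the column test, the residual algebra, `residue_eq_zero_iff_v_lt_one`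
import Literature.NumberTheory.Automorphic.UnitaryLatticeTreeFixedCostarCoords          -- ★ T2-E′ FILE 3 (F0P2-p06 (g10)): `mapGL_dual_N₁_eq`, `vec_mem_N₁_iff`, `mapGL_N₁_sup_span_vec_eq_iff`, `isSelfDualLattice_N₁_sup_span_vec_iff`
import HarnessLib

/-!
# The lattice graph of a hermitian space — S-a3: A RESIDUALLY UNIPOTENT ELEMENT OF A TYPE-TWO VERTEX STABILISER FIXES A SELF-DUAL NEIGHBOUR
# (Bruhat–Tits 1972 §10; Serre, *Trees* I.6.1, II.1.1)

Topic `NumberTheory/Automorphic`; namespace `Literature.NumberTheory.Automorphic.UnitaryLatticeTree`.  THEOREMS ONLY (no definition, no instance, no notation, no named fact,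
no `sorry`).  Cell `pub/hodgecm-mathlib` (D-0151), crux H413 = `stmt-HodgeConjecture-24833`; road «S3-tree», architect A-p16 (g29) RULING A-66 (1)–(3): «SPAN-0» cuts the relevant
(residually unipotent) locus by stabilisers of SELF-DUAL vertices only, and THIS brick is why that suffices — a residually unipotent `δ ∈ U(σ, J₀)` (`charpoly δ ≡ charpoly 1 = (X − 1)³
mod 𝔪`, coefficientwise) that fixes a TYPE-TWO vertex `N` of the `U(3)` lattice tree fixes one of its SELF-DUAL neighbours `N < M < N^♯`.  MATHEMATICS: `N^♯∕N` is a hyperbolic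
hermitian plane over the residue field, `δ̄` acts on it as a unipotent isometry `ū = [[ā₀₀, ā₀₂], [ā₂₀, ā₂₂]]`, and a unipotent isometry of a hyperbolic plane fixes an isotropic
point: `[1 : 0]` when `ā₂₀ = 0`, and `[ā₀₀ − 1 : ā₂₀]` otherwise (`= Im(ū − 1)`, or `[0 : 1]` when also `ā₀₂ = 0`).  WRITTEN in the tree's currency at `N₁ = latt diag(1,1,ϖ)`
(★ T1d′ normal form ∕ `htr₂` transport `N = u·N₁`), with F0P2-p06 (g10)'s ★ coordinates `w(a,b) = (a∕ϖ, 0, b)` on `N₁^♯∕N₁`, fixed-point test `mapGL_N₁_sup_span_vec_eq_iff` and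
self-duality test `isSelfDualLattice_N₁_sup_span_vec_iff` consumed BY NAME; the residual algebra (the `2 × 2` corner of a residually unipotent `3 × 3` matrix is nilpotent; the
isometry relations force the line `[ā₀₀ − 1 : ā₂₀]` to be isotropic) is done in the residue field `𝓀[K]` of `𝒪[K]` (FILE 1 §2) and lifted through `IsLocalRing.residue` (§1 here).
Hypotheses as in the sibling ★ files: `hd : UnramifiedLocalConjDatum σ ϖ`, `htr₂` («`U(J₀)` acts transitively on type-two vertices», discharged separately by T1d′).
HONEST LABEL: HC_CM is proved only modulo the 2 remaining named inputs (hLiu418 24832, h413 24833) until rung 0 closes; nothing printed is asserted here (elementary lattice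
algebra over a valuation ring); S3 stays a print row until the road's END lands.

* FILE 1 `UnitaryLatticeTreeResiduallyUnipotentCorner` (this seat): integral matrices, the residually unipotent power (Cayley–Hamilton), the column test, the residual algebra.
* §1 **`exists_isSelfDualLattice_gt_N₁_mapGL_eq`** (the brick at `N₁`); §2 the HEAD **`exists_isSelfDualLattice_gt_mapGL_eq_of_charpoly`** (any type-two `N`, by `htr₂`-transport).

## References
* [BruhatTits1972] F. Bruhat, J. Tits, *Groupes réductifs sur un corps local I*, Publ. Math. IHÉS 41 (1972), §10 (lattice models; the tree of a rank-one unitary group).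
* [Serre1980Trees] J.-P. Serre, *Trees* (1980), Ch. I §6.1 (automorphisms of a tree and fixed vertices), Ch. II §1.1 (lattices and adjacency).
* [Jacobowitz1962] R. Jacobowitz, *Hermitian forms over local fields*, Amer. J. Math. 84 (1962), §7–§8 (unimodular and `𝔭`-modular hermitian lattices).
-/

set_option autoImplicit false

noncomputable section

open scoped Valued WithZero Matrix MatrixGroups
open Polynomial

namespace Literature.NumberTheory.Automorphic.UnitaryLatticeTree

open Literature.NumberTheory.Automorphic Literature.NumberTheory.Automorphic.HermitianLattice
open Literature.NumberTheory.Automorphic.CartanUnique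

variable {K : Type*} [Field K] [Valued K ℤᵐ⁰] {σ : K →+* K} {ϖ : K} {N : ℕ}

/-! ## §1 The brick at `N₁ = latt diag(1,1,ϖ)` -/

set_option maxHeartbeats 1600000 in
/-- **S-a3 AT `N₁`.**  Let `γ ∈ U(σ, J₀)` fix `N₁ = latt diag(1,1,ϖ)` and have `charpoly γ ≡ charpoly 1 mod 𝔪` coefficientwise.  Then `γ` fixes a SELF-DUAL vertex `M` with `N₁ < M`:
in the coordinates `w(a,b) = (a∕ϖ, 0, b)` of `N₁^♯∕N₁` (★ F0P2-p06), `M = N₁ + 𝒪·w(1, 0)` if `ϖ⁻¹γ₂₀ ∈ 𝔪`, and `M = N₁ + 𝒪·w(γ₀₀ − 1, ϖ⁻¹γ₂₀)` otherwise.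
[cite: BruhatTits1972, §10] [cite: Serre1980Trees, I.6.1 and II.1.1] [cite: Jacobowitz1962, §7–§8] -/
theorem exists_isSelfDualLattice_gt_N₁_mapGL_eq (hd : UnramifiedLocalConjDatum σ ϖ) (γ : unitaryGroupOfForm σ ((StdForm.antidiagonal 3).over K))
    (hγ : mapGL (γ : GL (Fin 3) K) (latt (Matrix.diagonal ![(1 : K), 1, ϖ])) = latt (Matrix.diagonal ![(1 : K), 1, ϖ]))
    (hγ1 : ∀ i, Valued.v (((γ : GL (Fin 3) K) : Matrix (Fin 3) (Fin 3) K).charpoly.coeff i - (1 : Matrix (Fin 3) (Fin 3) K).charpoly.coeff i) < 1) :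
    ∃ M : Submodule 𝒪[K] (Fin 3 → K), IsSelfDualLattice σ ϖ ((StdForm.antidiagonal 3).over K) M ∧
      latt (Matrix.diagonal ![(1 : K), 1, ϖ]) < M ∧ mapGL (γ : GL (Fin 3) K) M = M := by
  have hϖ0 : ϖ ≠ 0 := uniformizer_ne_zero hd.vϖ
  have hvϖ0 : Valued.v ϖ ≠ 0 := (Valuation.ne_zero_iff _).2 hϖ0
  have hϖ1 : Valued.v ϖ < 1 := by rw [hd.vϖ, ← WithZero.exp_zero, WithZero.exp_lt_exp]; omega
  have hlt : ∀ z : K, Valued.v z < 1 ↔ Valued.v z ≤ Valued.v ϖ := fun z => by rw [hd.vϖ]; exact v_lt_one_iff z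
  have hvinv : Valued.v ϖ⁻¹ * Valued.v ϖ = 1 := by rw [← map_mul, inv_mul_cancel₀ hϖ0, map_one]
  set g : Matrix (Fin 3) (Fin 3) K := ((γ : GL (Fin 3) K) : Matrix (Fin 3) (Fin 3) K) with hgdef
  -- the isometry relations we need: `B₀(γe₂, γe₂) = 0` (column `e₂` isotropic) and `B₀(γe₀, γe₂) = 1`
  have r0 : Fin.rev (0 : Fin 3) = 2 := by decide
  have r1 : Fin.rev (1 : Fin 3) = 1 := by decide
  have r2 : Fin.rev (2 : Fin 3) = 0 := by decide
  have hU := (mem_unitaryGroupOfForm_antidiagonal_iff (γ : GL (Fin 3) K)).1 γ.2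
  have hE2K : σ (g 0 2) * g 2 2 + σ (g 1 2) * g 1 2 + σ (g 2 2) * g 0 2 = 0 := by
    have h := hU (Pi.single 2 1) (Pi.single 2 1)
    rw [B₀_single_single, B₀_apply, Fin.sum_univ_three, Matrix.mulVec_single_one, r0, r1, r2, if_neg (by decide)] at h
    simp only [Matrix.col_apply] at h
    exact h
  have hE3K : σ (g 0 0) * g 2 2 + σ (g 1 0) * g 1 2 + σ (g 2 0) * g 0 2 = 1 := by
    have h := hU (Pi.single 0 1) (Pi.single 2 1)
    rw [B₀_single_single, B₀_apply, Fin.sum_univ_three, Matrix.mulVec_single_one, Matrix.mulVec_single_one, r0, r1, r2, if_pos rfl] at h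
    simp only [Matrix.col_apply] at h
    exact h
  -- §A the column tests on `N₁` and on `N₁^♯ = latt diag(ϖ⁻¹,1,1)`
  have hdd : ∀ i, (![(1 : K), 1, ϖ] : Fin 3 → K) i ≠ 0 := by intro i; fin_cases i <;> simp [hϖ0]
  have hdd' : ∀ i, (![ϖ⁻¹, (1 : K), 1] : Fin 3 → K) i ≠ 0 := by intro i; fin_cases i <;> simp [hϖ0]
  have hN := v_apply_mul_le_of_mapGL_latt_diagonal_le hdd (g := (γ : GL (Fin 3) K)) hγ.le
  have hD := v_apply_mul_le_of_mapGL_latt_diagonal_le hdd' (g := (γ : GL (Fin 3) K)) (mapGL_dual_N₁_eq hd.vσ hd.σϖ hd.vϖ γ hγ).le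
  have e0 : (![(1 : K), 1, ϖ] : Fin 3 → K) 0 = 1 := rfl
  have e1 : (![(1 : K), 1, ϖ] : Fin 3 → K) 1 = 1 := rfl
  have e2 : (![(1 : K), 1, ϖ] : Fin 3 → K) 2 = ϖ := rfl
  have f0 : (![ϖ⁻¹, (1 : K), 1] : Fin 3 → K) 0 = ϖ⁻¹ := rfl
  have f1 : (![ϖ⁻¹, (1 : K), 1] : Fin 3 → K) 1 = 1 := rfl
  have f2 : (![ϖ⁻¹, (1 : K), 1] : Fin 3 → K) 2 = 1 := rfl
  have h00 : Valued.v (g 0 0) ≤ 1 := by have h := hN 0 0; rw [e0, mul_one, map_one] at h; exact h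
  have h01 : Valued.v (g 0 1) ≤ 1 := by have h := hN 0 1; rw [e0, e1, mul_one, map_one] at h; exact h
  have h02 : Valued.v (ϖ * g 0 2) ≤ 1 := by have h := hN 0 2; rw [e0, e2, mul_comm, map_one] at h; exact h
  have h11 : Valued.v (g 1 1) ≤ 1 := by have h := hN 1 1; rw [e1, mul_one, map_one] at h; exact h
  have h22 : Valued.v (g 2 2) ≤ 1 := by have h := hD 2 2; rw [f2, mul_one, map_one] at h; exact h
  have h12 : Valued.v (g 1 2) ≤ 1 := by have h := hD 1 2; rw [f1, f2, mul_one, map_one] at h; exact h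
  have h20 : Valued.v (ϖ⁻¹ * g 2 0) ≤ 1 := by have h := hD 2 0; rw [f2, f0, mul_comm, map_one] at h; exact h
  have h10 : Valued.v (g 1 0) < 1 := by
    have h := hD 1 0
    rw [f1, f0, map_one, map_mul] at h
    rw [hlt]
    calc Valued.v (g 1 0) = Valued.v (g 1 0) * Valued.v ϖ⁻¹ * Valued.v ϖ := by rw [mul_assoc, hvinv, mul_one]
      _ ≤ 1 * Valued.v ϖ := mul_le_mul' h le_rfl
      _ = Valued.v ϖ := one_mul _
  have h12' : Valued.v (ϖ * g 1 2) < 1 := by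
    rw [hlt, map_mul]; exact mul_le_of_le_one_right' h12
  have h21 : Valued.v (ϖ⁻¹ * g 2 1) ≤ 1 := by
    have h := hN 2 1
    rw [e1, e2, mul_one] at h
    rw [map_mul]
    calc Valued.v ϖ⁻¹ * Valued.v (g 2 1) ≤ Valued.v ϖ⁻¹ * Valued.v ϖ := mul_le_mul' le_rfl h
      _ = 1 := hvinv
  -- §A′ the pure `K`-identities used below (stated here, before the residue bookkeeping, to keep elaboration light)
  have hσle : ∀ {x : K}, Valued.v x ≤ 1 → Valued.v (σ x) ≤ 1 := fun hx => by rwa [hd.vσ]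
  have hσlt : ∀ {x : K}, Valued.v x < 1 → Valued.v (σ x) < 1 := fun hx => by rwa [hd.vσ]
  have ha : Valued.v (g 0 0 - 1) ≤ 1 := by
    calc Valued.v (g 0 0 - 1) ≤ max (Valued.v (g 0 0)) (Valued.v (1 : K)) := Valuation.map_sub _ _ _
      _ ≤ 1 := max_le h00 (by rw [map_one])
  have hB' : Valued.v (ϖ * σ (g 0 2)) ≤ 1 := by rw [map_mul, hd.vσ, ← map_mul]; exact h02
  have hC' : Valued.v (ϖ⁻¹ * σ (g 2 0)) ≤ 1 := by rw [map_mul, hd.vσ, ← map_mul]; exact h20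
  have hϖϖ : ϖ⁻¹ * ϖ = 1 := inv_mul_cancel₀ hϖ0
  have hvalS : σ ((g 0 0 - 1) + (g 2 2 - 1)) = (σ (g 0 0) - 1) + (σ (g 2 2) - 1) := by rw [map_add, map_sub, map_sub, map_one]
  have hvalR : σ ((g 0 0 - 1) * (g 2 2 - 1) - (ϖ * g 0 2) * (ϖ⁻¹ * g 2 0)) = (σ (g 0 0) - 1) * (σ (g 2 2) - 1) - (ϖ * σ (g 0 2)) * (ϖ⁻¹ * σ (g 2 0)) := by
    rw [map_sub, map_mul, map_mul, map_sub, map_sub, map_one, map_mul, map_mul, map_inv₀, hd.σϖ]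
  have hvalE : σ (g 0 0 - 1) = σ (g 0 0) - 1 := by rw [map_sub, map_one]
  have hvalI : σ (g 0 0 - 1) * (ϖ⁻¹ * g 2 0) + σ (ϖ⁻¹ * g 2 0) * (g 0 0 - 1) = (σ (g 0 0) - 1) * (ϖ⁻¹ * g 2 0) + (ϖ⁻¹ * σ (g 2 0)) * (g 0 0 - 1) := by
    rw [map_sub, map_one, map_mul, map_inv₀, hd.σϖ]
  have hK2 : Valued.v (ϖ * σ (g 0 2) * g 2 2 + σ (g 2 2) * (ϖ * g 0 2)) < 1 := by
    have heq : ϖ * σ (g 0 2) * g 2 2 + σ (g 2 2) * (ϖ * g 0 2) = -(σ (g 1 2) * (ϖ * g 1 2)) := by linear_combination ϖ * hE2K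
    rw [heq, Valuation.map_neg, map_mul]; exact lt_of_le_of_lt (mul_le_of_le_one_left' (hσle h12)) h12'
  have hK3 : Valued.v (σ (g 0 0) * g 2 2 + ϖ⁻¹ * σ (g 2 0) * (ϖ * g 0 2) - 1) < 1 := by
    have heq : σ (g 0 0) * g 2 2 + ϖ⁻¹ * σ (g 2 0) * (ϖ * g 0 2) - 1 = -(σ (g 1 0) * g 1 2) := by
      linear_combination hE3K + (σ (g 2 0) * g 0 2) * hϖϖ
    rw [heq, Valuation.map_neg, map_mul]; exact lt_of_le_of_lt (mul_le_of_le_one_right' h12) (hσlt h10)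
  have heq1 : g 0 0 * (g 0 0 - 1) + ϖ * g 0 2 * (ϖ⁻¹ * g 2 0) - 1 * (g 0 0 - 1) = (g 0 0 - 1) ^ 2 + (ϖ * g 0 2) * (ϖ⁻¹ * g 2 0) := by ring
  have heq2 : ϖ⁻¹ * g 2 0 * (g 0 0 - 1) + g 2 2 * (ϖ⁻¹ * g 2 0) - 1 * (ϖ⁻¹ * g 2 0) = (ϖ⁻¹ * g 2 0) * ((g 0 0 - 1) + (g 2 2 - 1)) := by ring
  -- §B the integral conjugate `A = diag(1,1,ϖ⁻¹)·g·diag(1,1,ϖ)` and its residually unipotent cube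
  set A : Matrix (Fin 3) (Fin 3) K := !![g 0 0, g 0 1, ϖ * g 0 2; g 1 0, g 1 1, ϖ * g 1 2; ϖ⁻¹ * g 2 0, ϖ⁻¹ * g 2 1, g 2 2] with hAdef
  have hAconj : A = Matrix.diagonal ![(1 : K), 1, ϖ⁻¹] * g * Matrix.diagonal ![(1 : K), 1, ϖ] := by
    ext i j; fin_cases i <;> fin_cases j <;> simp [hAdef, Matrix.diagonal_mul, Matrix.mul_diagonal, mul_comm]
    field_simp
  have hAint : IsIntMatrix A := by
    intro i j
    fin_cases i <;> fin_cases j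
    · simpa [hAdef] using h00
    · simpa [hAdef] using h01
    · simpa [hAdef] using h02
    · simpa [hAdef] using h10.le
    · simpa [hAdef] using h11
    · simpa [hAdef] using h12'.le
    · simpa [hAdef] using h20
    · simpa [hAdef] using h21
    · simpa [hAdef] using h22
  have hAchar : A.charpoly = g.charpoly := by
    have hDD : Matrix.diagonal ![(1 : K), 1, ϖ] * Matrix.diagonal ![(1 : K), 1, ϖ⁻¹] = 1 := by
      rw [Matrix.diagonal_mul_diagonal, ← Matrix.diagonal_one]; congr 1; funext i; fin_cases i <;> simp [hϖ0]
    rw [hAconj, Matrix.mul_assoc, Matrix.charpoly_mul_comm, Matrix.mul_assoc, hDD, Matrix.mul_one]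
  have hcube : ∀ j l, Valued.v (((A - 1) ^ 3 : Matrix (Fin 3) (Fin 3) K) j l) < 1 := fun j l =>
    v_pow_sub_one_apply_lt_one (N := 3) hAint (fun i => by rw [hAchar]; exact hγ1 i) j l
  -- §C residues
  have memO : ∀ {x : K}, Valued.v x ≤ 1 → x ∈ 𝒪[K] := fun hx => (Valuation.mem_valuationSubring_iff _ _).2 hx
  set AO : Matrix (Fin 3) (Fin 3) 𝒪[K] := Matrix.of fun i j => (⟨A i j, memO (hAint i j)⟩ : 𝒪[K]) with hAOdef
  have hAOval : AO.map (algebraMap 𝒪[K] K) = A := by ext i j; rfl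
  set Ab : Matrix (Fin 3) (Fin 3) 𝓀[K] := AO.map (IsLocalRing.residue 𝒪[K]) with hAbdef
  have hAb3 : (Ab - 1) ^ 3 = 0 := by
    have hO : ∀ j l, IsLocalRing.residue 𝒪[K] (((AO - 1) ^ 3 : Matrix (Fin 3) (Fin 3) 𝒪[K]) j l) = 0 := by
      intro j l
      rw [residue_eq_zero_iff_v_lt_one]
      have hval : ((((AO - 1) ^ 3 : Matrix (Fin 3) (Fin 3) 𝒪[K]) j l : 𝒪[K]) : K) = ((A - 1) ^ 3 : Matrix (Fin 3) (Fin 3) K) j l := by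
        have h := congrArg (fun M : Matrix (Fin 3) (Fin 3) K => M j l) (((algebraMap 𝒪[K] K).mapMatrix).map_pow (AO - 1) 3)
        simp only [map_sub, map_one, RingHom.mapMatrix_apply, hAOval] at h
        rw [← h]; rfl
      rw [hval]; exact hcube j l
    have h := ((IsLocalRing.residue 𝒪[K]).mapMatrix).map_pow (AO - 1) 3
    simp only [map_sub, map_one, RingHom.mapMatrix_apply] at h
    rw [← hAbdef] at h
    rw [← h]
    ext j l
    rw [Matrix.map_apply, hO, Matrix.zero_apply]
  have hAb : ∀ i j, Ab i j = IsLocalRing.residue 𝒪[K] ⟨A i j, memO (hAint i j)⟩ := fun i j => rfl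
  have hAb10 : Ab 1 0 = 0 := by rw [hAb, residue_eq_zero_iff_v_lt_one]; simpa [hAdef] using h10
  have hAb12 : Ab 1 2 = 0 := by rw [hAb, residue_eq_zero_iff_v_lt_one]; simpa [hAdef] using h12'
  -- §D the two cases on `c̄ = residue (ϖ⁻¹ γ₂₀)`
  by_cases hc : Valued.v (ϖ⁻¹ * g 2 0) < 1
  · -- CASE `c̄ = 0`: the point `[1 : 0]`, `M = N₁ + 𝒪·(1∕ϖ, 0, 0) = latt diag(ϖ⁻¹, 1, ϖ)`
    have hAb20 : Ab 2 0 = 0 := by rw [hAb, residue_eq_zero_iff_v_lt_one]; simpa [hAdef] using hc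
    have hε : Valued.v (g 0 0 - 1) < 1 := by
      have h := residual_corner_eq_one_of_lower_zero hAb3 hAb10 hAb12 hAb20
      rw [hAb, ← map_one (IsLocalRing.residue 𝒪[K]), ← map_sub, residue_eq_zero_iff_v_lt_one] at h
      simpa [hAdef] using h
    refine ⟨latt (Matrix.diagonal ![(1 : K), 1, ϖ]) ⊔ Submodule.span 𝒪[K] {(![1 / ϖ, 0, 0] : Fin 3 → K)}, ?_, ?_, ?_⟩
    · rw [isSelfDualLattice_N₁_sup_span_vec_iff hd.σσ hd.vσ hd.σϖ hd.vϖ (le_of_eq (map_one _)) (by rw [map_zero]; exact zero_le) (Or.inl (map_one _))]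
      rw [map_one, map_zero, one_mul, mul_one, add_zero, map_zero]; exact zero_lt_one
    · refine lt_of_le_of_ne le_sup_left fun heq => ?_
      have hw : (![1 / ϖ, 0, 0] : Fin 3 → K) ∈ latt (Matrix.diagonal ![(1 : K), 1, ϖ]) := by
        rw [heq]; exact Submodule.mem_sup_right (Submodule.mem_span_singleton_self _)
      rw [vec_mem_N₁_iff hd.vϖ] at hw
      simp at hw
    · rw [mapGL_N₁_sup_span_vec_eq_iff hd.vσ hd.σϖ hd.vϖ γ hγ (le_of_eq (map_one _)) (by rw [map_zero]; exact zero_le) (Or.inl (map_one _))]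
      refine ⟨1, map_one _, ?_, ?_⟩
      · simpa [← hgdef] using hε
      · simpa [← hgdef] using hc
  · -- CASE `c̄ ≠ 0`: the point `[γ₀₀ − 1 : ϖ⁻¹γ₂₀]`
    have hc1 : Valued.v (ϖ⁻¹ * g 2 0) = 1 := le_antisymm h20 (not_lt.1 hc)
    have hAb20 : Ab 2 0 ≠ 0 := by
      rw [hAb, Ne, residue_eq_zero_iff_v_lt_one, not_lt]; simpa [hAdef] using hc1.ge
    obtain ⟨hS, hR⟩ := residual_corner_trace_det hAb3 hAb10 hAb12 hAb20
    -- the atoms of `𝒪` we compute with (`o00 o22 ob oc` and the conjugates `oX oY oB oC`), and their residues `x y b c ∕ X Y B C`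
    obtain ⟨o00, ho00⟩ : ∃ o : 𝒪[K], o = ⟨g 0 0, memO h00⟩ := ⟨_, rfl⟩
    obtain ⟨o22, ho22⟩ : ∃ o : 𝒪[K], o = ⟨g 2 2, memO h22⟩ := ⟨_, rfl⟩
    obtain ⟨ob, hob⟩ : ∃ o : 𝒪[K], o = ⟨ϖ * g 0 2, memO h02⟩ := ⟨_, rfl⟩
    obtain ⟨oc, hoc⟩ : ∃ o : 𝒪[K], o = ⟨ϖ⁻¹ * g 2 0, memO h20⟩ := ⟨_, rfl⟩
    obtain ⟨oX, hoX⟩ : ∃ o : 𝒪[K], o = ⟨σ (g 0 0), memO (hσle h00)⟩ := ⟨_, rfl⟩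
    obtain ⟨oY, hoY⟩ : ∃ o : 𝒪[K], o = ⟨σ (g 2 2), memO (hσle h22)⟩ := ⟨_, rfl⟩
    obtain ⟨oB, hoB⟩ : ∃ o : 𝒪[K], o = ⟨ϖ * σ (g 0 2), memO hB'⟩ := ⟨_, rfl⟩
    obtain ⟨oC, hoC⟩ : ∃ o : 𝒪[K], o = ⟨ϖ⁻¹ * σ (g 2 0), memO hC'⟩ := ⟨_, rfl⟩
    have c00 : (o00 : K) = g 0 0 := by rw [ho00]
    have c22 : (o22 : K) = g 2 2 := by rw [ho22]
    have cb : (ob : K) = ϖ * g 0 2 := by rw [hob]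
    have cc : (oc : K) = ϖ⁻¹ * g 2 0 := by rw [hoc]
    have cX : (oX : K) = σ (g 0 0) := by rw [hoX]
    have cY : (oY : K) = σ (g 2 2) := by rw [hoY]
    have cB : (oB : K) = ϖ * σ (g 0 2) := by rw [hoB]
    have cC : (oC : K) = ϖ⁻¹ * σ (g 2 0) := by rw [hoC]
    obtain ⟨rx, hrx⟩ : ∃ r : 𝓀[K], r = IsLocalRing.residue 𝒪[K] o00 := ⟨_, rfl⟩
    obtain ⟨ry, hry⟩ : ∃ r : 𝓀[K], r = IsLocalRing.residue 𝒪[K] o22 := ⟨_, rfl⟩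
    obtain ⟨rb, hrb⟩ : ∃ r : 𝓀[K], r = IsLocalRing.residue 𝒪[K] ob := ⟨_, rfl⟩
    obtain ⟨rc, hrc⟩ : ∃ r : 𝓀[K], r = IsLocalRing.residue 𝒪[K] oc := ⟨_, rfl⟩
    obtain ⟨rX, hrX⟩ : ∃ r : 𝓀[K], r = IsLocalRing.residue 𝒪[K] oX := ⟨_, rfl⟩
    obtain ⟨rY, hrY⟩ : ∃ r : 𝓀[K], r = IsLocalRing.residue 𝒪[K] oY := ⟨_, rfl⟩
    obtain ⟨rB, hrB⟩ : ∃ r : 𝓀[K], r = IsLocalRing.residue 𝒪[K] oB := ⟨_, rfl⟩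
    obtain ⟨rC, hrC⟩ : ∃ r : 𝓀[K], r = IsLocalRing.residue 𝒪[K] oC := ⟨_, rfl⟩
    have hx00 : Ab 0 0 = rx := by rw [hrx, ho00]; rfl
    have hx22 : Ab 2 2 = ry := by rw [hry, ho22]; rfl
    have hx02 : Ab 0 2 = rb := by rw [hrb, hob]; rfl
    have hx20 : Ab 2 0 = rc := by rw [hrc, hoc]; rfl
    rw [hx00, hx22] at hS
    rw [hx00, hx22, hx02, hx20] at hR
    rw [hx20] at hAb20
    -- the valuation ↔ residue dictionary on compound elements: `↑` of a polynomial in the atoms is the polynomial in the `K`-values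
    -- trace and determinant at the `K` level, then conjugated
    have hSK : Valued.v ((g 0 0 - 1) + (g 2 2 - 1)) < 1 := by
      have h : IsLocalRing.residue 𝒪[K] (o00 - 1 + (o22 - 1)) = 0 := by rw [map_add, map_sub, map_sub, map_one, ← hrx, ← hry]; exact hS
      rw [residue_eq_zero_iff_v_lt_one] at h
      have hval : ((o00 - 1 + (o22 - 1) : 𝒪[K]) : K) = (g 0 0 - 1) + (g 2 2 - 1) := by push_cast; rw [c00, c22]
      rwa [hval] at h
    have hRK : Valued.v ((g 0 0 - 1) * (g 2 2 - 1) - (ϖ * g 0 2) * (ϖ⁻¹ * g 2 0)) < 1 := by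
      have h : IsLocalRing.residue 𝒪[K] ((o00 - 1) * (o22 - 1) - ob * oc) = 0 := by
        rw [map_sub, map_mul, map_mul, map_sub, map_sub, map_one, ← hrx, ← hry, ← hrb, ← hrc]; exact hR
      rw [residue_eq_zero_iff_v_lt_one] at h
      have hval : (((o00 - 1) * (o22 - 1) - ob * oc : 𝒪[K]) : K) = (g 0 0 - 1) * (g 2 2 - 1) - (ϖ * g 0 2) * (ϖ⁻¹ * g 2 0) := by push_cast; rw [c00, c22, cb, cc]
      rwa [hval] at h
    have hS' : (rX - 1) + (rY - 1) = 0 := by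
      have hSK' : Valued.v ((σ (g 0 0) - 1) + (σ (g 2 2) - 1)) < 1 := by rw [← hvalS, hd.vσ]; exact hSK
      have h : IsLocalRing.residue 𝒪[K] (oX - 1 + (oY - 1)) = 0 := by
        rw [residue_eq_zero_iff_v_lt_one]
        have hval : ((oX - 1 + (oY - 1) : 𝒪[K]) : K) = (σ (g 0 0) - 1) + (σ (g 2 2) - 1) := by push_cast; rw [cX, cY]
        rw [hval]; exact hSK'
      rw [map_add, map_sub, map_sub, map_one, ← hrX, ← hrY] at h; exact h
    have hR' : (rX - 1) * (rY - 1) - rB * rC = 0 := by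
      have hRK' : Valued.v ((σ (g 0 0) - 1) * (σ (g 2 2) - 1) - (ϖ * σ (g 0 2)) * (ϖ⁻¹ * σ (g 2 0))) < 1 := by
        rw [← hvalR, hd.vσ]; exact hRK
      have h : IsLocalRing.residue 𝒪[K] ((oX - 1) * (oY - 1) - oB * oC) = 0 := by
        rw [residue_eq_zero_iff_v_lt_one]
        have hval : (((oX - 1) * (oY - 1) - oB * oC : 𝒪[K]) : K) = (σ (g 0 0) - 1) * (σ (g 2 2) - 1) - (ϖ * σ (g 0 2)) * (ϖ⁻¹ * σ (g 2 0)) := by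
          push_cast; rw [cX, cY, cB, cC]
        rw [hval]; exact hRK'
      rw [map_sub, map_mul, map_mul, map_sub, map_sub, map_one, ← hrX, ← hrY, ← hrB, ← hrC] at h; exact h
    -- the isometry relations in the residue field (`hK2`, `hK3` above)
    have hE2 : rB * ry + rY * rb = 0 := by
      have h : IsLocalRing.residue 𝒪[K] (oB * o22 + oY * ob) = 0 := by
        rw [residue_eq_zero_iff_v_lt_one]
        have hval : ((oB * o22 + oY * ob : 𝒪[K]) : K) = ϖ * σ (g 0 2) * g 2 2 + σ (g 2 2) * (ϖ * g 0 2) := by push_cast; rw [cB, c22, cY, cb]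
        rw [hval]; exact hK2
      rw [map_add, map_mul, map_mul, ← hrB, ← hry, ← hrY, ← hrb] at h; exact h
    have hE3 : rX * ry + rC * rb = 1 := by
      have h : IsLocalRing.residue 𝒪[K] (oX * o22 + oC * ob) = IsLocalRing.residue 𝒪[K] 1 := by
        refine residue_eq_of_v_sub_lt_one ?_
        have hval : ((oX * o22 + oC * ob : 𝒪[K]) : K) - ((1 : 𝒪[K]) : K) = σ (g 0 0) * g 2 2 + ϖ⁻¹ * σ (g 2 0) * (ϖ * g 0 2) - 1 := by push_cast; rw [cX, c22, cC, cb]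
        rw [hval]; exact hK3
      rw [map_add, map_mul, map_mul, map_one, ← hrX, ← hry, ← hrC, ← hrb] at h; exact h
    -- the residual identities we lift back to `K`: `ε² + bc ∈ 𝔪` (fixed-point test) and `σ(ε)c + σ(c)ε ∈ 𝔪` (isotropy)
    have hfixK : Valued.v ((g 0 0 - 1) ^ 2 + (ϖ * g 0 2) * (ϖ⁻¹ * g 2 0)) < 1 := by
      have h : IsLocalRing.residue 𝒪[K] ((o00 - 1) ^ 2 + ob * oc) = 0 := by
        rw [map_add, map_pow, map_mul, map_sub, map_one, ← hrx, ← hrb, ← hrc]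
        linear_combination (rx - 1) * hS - hR
      rw [residue_eq_zero_iff_v_lt_one] at h
      have hval : (((o00 - 1) ^ 2 + ob * oc : 𝒪[K]) : K) = (g 0 0 - 1) ^ 2 + (ϖ * g 0 2) * (ϖ⁻¹ * g 2 0) := by push_cast; rw [c00, cb, cc]
      rwa [hval] at h
    have hisoK : Valued.v (σ (g 0 0 - 1) * (ϖ⁻¹ * g 2 0) + σ (ϖ⁻¹ * g 2 0) * (g 0 0 - 1)) < 1 := by
      have hiso : (rX - 1) * rc + rC * (rx - 1) = 0 := by
        by_cases hb : Valued.v (ϖ * g 0 2) < 1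
        · -- `b̄ = 0`: then `ε² = −b̄c̄ = 0`, so `ε = 0` and (conjugating) `ε′ = 0`
          have hrb0 : rb = 0 := by rw [hrb, residue_eq_zero_iff_v_lt_one, cb]; exact hb
          have hε2 : (rx - 1) ^ 2 = 0 := by linear_combination (rx - 1) * hS - hR - rc * hrb0
          have hε : rx - 1 = 0 := pow_eq_zero_iff (n := 2) (by norm_num) |>.1 hε2
          have hεK : Valued.v (g 0 0 - 1) < 1 := by
            have h : IsLocalRing.residue 𝒪[K] (o00 - 1) = 0 := by rw [map_sub, map_one, ← hrx]; exact hε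
            rw [residue_eq_zero_iff_v_lt_one] at h
            have hval : ((o00 - 1 : 𝒪[K]) : K) = g 0 0 - 1 := by push_cast; rw [c00]
            rwa [hval] at h
          have hε' : rX - 1 = 0 := by
            have hεK' : Valued.v (σ (g 0 0) - 1) < 1 := by rw [← hvalE, hd.vσ]; exact hεK
            have h : IsLocalRing.residue 𝒪[K] (oX - 1) = 0 := by
              rw [residue_eq_zero_iff_v_lt_one]
              have hval : ((oX - 1 : 𝒪[K]) : K) = σ (g 0 0) - 1 := by push_cast; rw [cX]
              rw [hval]; exact hεK'
            rw [map_sub, map_one, ← hrX] at h; exact h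
          rw [hε, hε']; ring
        · have hrb1 : rb ≠ 0 := by rw [hrb, Ne, residue_eq_zero_iff_v_lt_one, cb]; exact hb
          have h := residual_transvection_line hS hS' hR hR' hE2 hE3 hrb1 hAb20
          linear_combination h
      have h : IsLocalRing.residue 𝒪[K] ((oX - 1) * oc + oC * (o00 - 1)) = 0 := by
        rw [map_add, map_mul, map_mul, map_sub, map_sub, map_one, ← hrX, ← hrc, ← hrC, ← hrx]; exact hiso
      rw [residue_eq_zero_iff_v_lt_one] at h
      have hval : (((oX - 1) * oc + oC * (o00 - 1) : 𝒪[K]) : K) = (σ (g 0 0) - 1) * (ϖ⁻¹ * g 2 0) + (ϖ⁻¹ * σ (g 2 0)) * (g 0 0 - 1) := by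
        push_cast; rw [cX, cc, cC, c00]
      rw [hvalI, ← hval]; exact h
    -- the neighbour `M = N₁ + 𝒪·w(γ₀₀ − 1, ϖ⁻¹γ₂₀)`
    refine ⟨latt (Matrix.diagonal ![(1 : K), 1, ϖ]) ⊔ Submodule.span 𝒪[K] {(![(g 0 0 - 1) / ϖ, 0, ϖ⁻¹ * g 2 0] : Fin 3 → K)}, ?_, ?_, ?_⟩
    · rw [isSelfDualLattice_N₁_sup_span_vec_iff hd.σσ hd.vσ hd.σϖ hd.vϖ ha h20 (Or.inr hc1)]
      exact hisoK
    · refine lt_of_le_of_ne le_sup_left fun heq => ?_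
      have hw : (![(g 0 0 - 1) / ϖ, 0, ϖ⁻¹ * g 2 0] : Fin 3 → K) ∈ latt (Matrix.diagonal ![(1 : K), 1, ϖ]) := by
        rw [heq]; exact Submodule.mem_sup_right (Submodule.mem_span_singleton_self _)
      rw [vec_mem_N₁_iff hd.vϖ] at hw
      exact absurd hw.2 (not_lt.2 hc1.ge)
    · rw [mapGL_N₁_sup_span_vec_eq_iff hd.vσ hd.σϖ hd.vϖ γ hγ ha h20 (Or.inr hc1)]
      refine ⟨1, map_one _, ?_, ?_⟩
      · have h := hfixK
        rw [← heq1] at h; exact h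
      · have h : Valued.v ((ϖ⁻¹ * g 2 0) * ((g 0 0 - 1) + (g 2 2 - 1))) < 1 := by
          rw [map_mul]; exact lt_of_le_of_lt (mul_le_of_le_one_left' h20) hSK
        rw [← heq2] at h; exact h

/-! ## §2 The head: any type-two vertex -/

/-- **S-a3: A RESIDUALLY UNIPOTENT ELEMENT OF A TYPE-TWO VERTEX STABILISER FIXES A SELF-DUAL NEIGHBOUR** (`N = 3`, unramified datum `hd`, `htr₂` = «`U(J₀)` acts
transitively on type-two vertices», carried exactly as ★ `latticeParent_spec_of_isVertexLattice_two` ∕ ★ `isTree_latticeGraph_three` carry it): if `δ ∈ U(σ, J₀)` has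
`charpoly δ ≡ charpoly 1 = (X − 1)³ mod 𝔪` coefficientwise and fixes a type-two vertex `N`, then `δ` fixes a SELF-DUAL vertex `M` with `N < M` (one of the `q + 1` neighbours
`N < M < N^♯`).  Transport: `N = u·N₁`, `δ′ := u⁻¹δu` fixes `N₁`, has the same characteristic polynomial, and `M = u·M′`. [cite: BruhatTits1972, §10] [cite: Serre1980Trees, I.6.1 and II.1.1] -/
theorem exists_isSelfDualLattice_gt_mapGL_eq_of_charpoly (hd : UnramifiedLocalConjDatum σ ϖ)
    (htr₂ : ∀ M : Submodule 𝒪[K] (Fin 3 → K), IsVertexLattice σ ϖ ((StdForm.antidiagonal 3).over K) 2 M →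
      ∃ u : unitaryGroupOfForm σ ((StdForm.antidiagonal 3).over K), M = mapGL (u : GL (Fin 3) K) (latt (Matrix.diagonal ![(1 : K), 1, ϖ])))
    {δ : GL (Fin 3) K} (hδ : δ ∈ unitaryGroupOfForm σ ((StdForm.antidiagonal 3).over K))
    (hδ1 : ∀ i, Valued.v ((δ : Matrix (Fin 3) (Fin 3) K).charpoly.coeff i - (1 : Matrix (Fin 3) (Fin 3) K).charpoly.coeff i) < 1)
    {N : Submodule 𝒪[K] (Fin 3 → K)} (hN : IsVertexLattice σ ϖ ((StdForm.antidiagonal 3).over K) 2 N) (hδN : mapGL δ N = N) :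
    ∃ M : Submodule 𝒪[K] (Fin 3 → K), IsSelfDualLattice σ ϖ ((StdForm.antidiagonal 3).over K) M ∧ N < M ∧ mapGL δ M = M := by
  obtain ⟨u, rfl⟩ := htr₂ N hN
  -- `δ′ := u⁻¹ δ u ∈ U(σ, J₀)` fixes `N₁` and has the same characteristic polynomial
  let γ : unitaryGroupOfForm σ ((StdForm.antidiagonal 3).over K) := u⁻¹ * ⟨δ, hδ⟩ * u
  have hγcoe : (γ : GL (Fin 3) K) = (u : GL (Fin 3) K)⁻¹ * δ * (u : GL (Fin 3) K) := rfl
  have hγN₁ : mapGL (γ : GL (Fin 3) K) (latt (Matrix.diagonal ![(1 : K), 1, ϖ])) = latt (Matrix.diagonal ![(1 : K), 1, ϖ]) := by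
    have h := congrArg (mapGL ((u : GL (Fin 3) K)⁻¹)) hδN
    rw [← mapGL_mul, ← mapGL_mul, ← mapGL_mul, inv_mul_cancel, mapGL_one] at h
    rw [hγcoe]; exact h
  have hγchar : (((γ : GL (Fin 3) K)) : Matrix (Fin 3) (Fin 3) K).charpoly = (δ : Matrix (Fin 3) (Fin 3) K).charpoly := by
    rw [hγcoe, Units.val_mul, Units.val_mul, Matrix.mul_assoc, Matrix.charpoly_mul_comm, Matrix.mul_assoc, ← Units.val_mul, mul_inv_cancel, Units.val_one, Matrix.mul_one]
  obtain ⟨M', hM', hlt, hfix⟩ := exists_isSelfDualLattice_gt_N₁_mapGL_eq hd γ hγN₁ (fun i => by rw [hγchar]; exact hδ1 i)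
  refine ⟨mapGL (u : GL (Fin 3) K) M', isVertexLattice_mapGL σ ϖ _ _ u.2 hM', (mapGL_lt_mapGL_iff _ _ _).2 hlt, ?_⟩
  -- `δ·(u·M′) = u·(δ′·M′) = u·M′`
  have hδu : δ * (u : GL (Fin 3) K) = (u : GL (Fin 3) K) * (γ : GL (Fin 3) K) := by rw [hγcoe, ← mul_assoc, ← mul_assoc, mul_inv_cancel, one_mul]
  rw [← mapGL_mul, hδu, mapGL_mul, hfix]

end Literature.NumberTheory.Automorphic.UnitaryLatticeTree

end
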